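import Summits.Ventures.PercRepro.HallDisjointDegree

/-!
# PercRepro — HALL'S CONDITION FOR DISJOINTNESS ON A FAMILY OF PAIRS OF MINIMUM DEGREE `≥ 3` (the lemma)
(p10, gen 5; `proofs/P10-HALLROW.md` §8; the counting facts, the reduction and the star / triangle cases are in
`HallDisjointDegree`)

Let `𝒞` be a family of 2-sets in which every point of a member lies in at least `3` members.  Then Hall's
condition for the DISJOINTNESS relation holds on `𝒞` — **`hall_disjoint_of_degree`**: every `𝒜 ⊆ 𝒞` has at least
`#𝒜` members of `𝒞` disjoint from some member of `𝒜`.  A pairwise intersecting `𝒜` is a star or contains a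
triangle (`hall_intersecting`, from `hall_star` / `hall_triangle`); if `𝒜` has two disjoint members `B₁, B₂`, the
members meeting every member of `𝒜` are pairs `{x, y}` with `x ∈ B₁`, `y ∈ B₂` (`perp_subset_pairs`), Hall's
condition holds for every such sub-family of the four pairs (`hall_of_subset_pairs`: intersecting, or two
opposite pairs are present and (H1) supplies the disjoint member of a third), and the reduction
`card_le_card_nbr_of_perp` transfers it to `𝒜`.

* `hall_intersecting` — the intersecting case;
* `perp_subset_pairs`, `exists_opposite`, `hall_of_subset_pairs` — the case of two disjoint members;
* **`hall_disjoint_of_degree`** — the lemma.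
-/

namespace PercRepro.HallDisjoint

open Finset

variable {α : Type} [DecidableEq α]

section Intersecting

variable {𝒞 : Finset (Finset α)} (hpair : ∀ C ∈ 𝒞, C.card = 2) (hdeg : ∀ C ∈ 𝒞, ∀ x ∈ C, 3 ≤ deg 𝒞 x)
include hpair hdeg

/-- **The intersecting case**: a pairwise intersecting `𝒜 ⊆ 𝒞` is a star or contains a triangle. -/
theorem hall_intersecting {𝒜 : Finset (Finset α)} (h𝒜 : 𝒜 ⊆ 𝒞)
    (hint : ∀ B₁ ∈ 𝒜, ∀ B₂ ∈ 𝒜, ¬ Disjoint B₁ B₂) : 𝒜.card ≤ (nbr 𝒞 𝒜).card := by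
  rcases 𝒜.eq_empty_or_nonempty with h0 | hne
  · subst h0
    rw [card_empty]
    exact Nat.zero_le _
  obtain ⟨B₀, hB₀⟩ := hne
  obtain ⟨a, b, hab, hB₀eq⟩ := card_eq_two.1 (hpair B₀ (h𝒜 hB₀))
  by_cases hstara : ∀ B ∈ 𝒜, a ∈ B
  · exact hall_star hpair hdeg h𝒜 hstara ⟨B₀, hB₀⟩
  · obtain ⟨B₁, hB₁, haB₁⟩ : ∃ B ∈ 𝒜, a ∉ B := by
      by_contra hcon
      apply hstara
      intro B hB
      by_contra h
      exact hcon ⟨B, hB, h⟩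
    have hbB₁ : b ∈ B₁ := by
      have m := hint B₀ hB₀ B₁ hB₁
      rw [not_disjoint_iff] at m
      obtain ⟨x, hx, hxB₁⟩ := m
      rw [hB₀eq, mem_insert, mem_singleton] at hx
      rcases hx with rfl | rfl
      · exact absurd hxB₁ haB₁
      · exact hxB₁
    obtain ⟨c, hcB₁, hcb, hB₁eq⟩ := exists_other (hpair B₁ (h𝒜 hB₁)) hbB₁
    have hac : a ≠ c := fun h => haB₁ (h ▸ hcB₁)
    by_cases hstarb : ∀ B ∈ 𝒜, b ∈ B
    · exact hall_star hpair hdeg h𝒜 hstarb ⟨B₀, hB₀⟩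
    · obtain ⟨B₂, hB₂, hbB₂⟩ : ∃ B ∈ 𝒜, b ∉ B := by
        by_contra hcon
        apply hstarb
        intro B hB
        by_contra h
        exact hcon ⟨B, hB, h⟩
      have haB₂ : a ∈ B₂ := by
        have m := hint B₀ hB₀ B₂ hB₂
        rw [not_disjoint_iff] at m
        obtain ⟨x, hx, hxB₂⟩ := m
        rw [hB₀eq, mem_insert, mem_singleton] at hx
        rcases hx with rfl | rfl
        · exact hxB₂
        · exact absurd hxB₂ hbB₂
      have hcB₂ : c ∈ B₂ := by
        have m := hint B₁ hB₁ B₂ hB₂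
        rw [not_disjoint_iff] at m
        obtain ⟨x, hx, hxB₂⟩ := m
        rw [hB₁eq, mem_insert, mem_singleton] at hx
        rcases hx with rfl | rfl
        · exact absurd hxB₂ hbB₂
        · exact hxB₂
      have hB₂eq : B₂ = {a, c} := eq_pair_of_mem (hpair B₂ (h𝒜 hB₂)) haB₂ hcB₂ hac
      rw [hB₀eq] at hB₀
      rw [hB₁eq] at hB₁
      rw [hB₂eq] at hB₂
      exact hall_triangle hpair hdeg h𝒜 hab (Ne.symm hcb) hac hB₀ hB₁ hB₂ hint

end Intersecting

/-! ### The case of two disjoint members -/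

/-- If `𝒜` has two disjoint members `B₁, B₂` (2-sets), every member meeting every member of `𝒜` is a pair
`{x, y}` with `x ∈ B₁`, `y ∈ B₂`. -/
theorem perp_subset_pairs {𝒞 𝒜 : Finset (Finset α)} (hpair : ∀ C ∈ 𝒞, C.card = 2) {B₁ B₂ : Finset α}
    (hB₁ : B₁ ∈ 𝒜) (hB₂ : B₂ ∈ 𝒜) (hd : Disjoint B₁ B₂) :
    perp 𝒞 𝒜 ⊆ (B₁ ×ˢ B₂).image (fun x : α × α => ({x.1, x.2} : Finset α)) := by
  intro C hC
  unfold perp at hC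
  rw [mem_filter] at hC
  obtain ⟨hC𝒞, hmeet⟩ := hC
  have hm1 := hmeet B₁ hB₁
  have hm2 := hmeet B₂ hB₂
  rw [not_disjoint_iff] at hm1 hm2
  obtain ⟨b₁, hb₁, hb₁C⟩ := hm1
  obtain ⟨b₂, hb₂, hb₂C⟩ := hm2
  have hne : b₁ ≠ b₂ := fun h => disjoint_left.1 hd hb₁ (h ▸ hb₂)
  rw [mem_image]
  exact ⟨(b₁, b₂), mem_product.2 ⟨hb₁, hb₂⟩, (eq_pair_of_mem (hpair C hC𝒞) hb₁C hb₂C hne).symm⟩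

/-- Two disjoint members of `K = {{x, y} : x ∈ B₁, y ∈ B₂}` (`B₁, B₂` disjoint 2-sets) are
`{u₁, v₁}`, `{u₂, v₂}` with `B₁ = {u₁, u₂}` and `B₂ = {v₁, v₂}`. -/
theorem exists_opposite {B₁ B₂ : Finset α} (h1 : B₁.card = 2) (h2 : B₂.card = 2) {D₁ D₂ : Finset α} (hD₁ : D₁ ∈ (B₁ ×ˢ B₂).image (fun x : α × α => ({x.1, x.2} : Finset α)))
    (hD₂ : D₂ ∈ (B₁ ×ˢ B₂).image (fun x : α × α => ({x.1, x.2} : Finset α))) (hdis : Disjoint D₁ D₂) :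
    ∃ u₁ u₂ v₁ v₂ : α, B₁ = {u₁, u₂} ∧ B₂ = {v₁, v₂} ∧ D₁ = {u₁, v₁} ∧ D₂ = {u₂, v₂} := by
  rw [mem_image] at hD₁ hD₂
  obtain ⟨⟨u₁, v₁⟩, h₁, rfl⟩ := hD₁
  obtain ⟨⟨u₂, v₂⟩, h₂, rfl⟩ := hD₂
  rw [mem_product] at h₁ h₂
  simp only at h₁ h₂
  have hu : u₁ ≠ u₂ := fun h => disjoint_left.1 hdis (mem_insert_self _ _) (h ▸ mem_insert_self _ _)
  have hv : v₁ ≠ v₂ := fun h =>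
    disjoint_left.1 hdis (mem_insert_of_mem (mem_singleton_self _)) (h ▸ mem_insert_of_mem (mem_singleton_self _))
  exact ⟨u₁, u₂, v₁, v₂, eq_pair_of_mem h1 h₁.1 h₂.1 hu, eq_pair_of_mem h2 h₁.2 h₂.2 hv, rfl, rfl⟩

section Pairs

variable {𝒞 : Finset (Finset α)} (hpair : ∀ C ∈ 𝒞, C.card = 2) (hdeg : ∀ C ∈ 𝒞, ∀ x ∈ C, 3 ≤ deg 𝒞 x)
include hpair hdeg

/-- **Hall for a sub-family of `K`**: `𝒜' ⊆ 𝒞` whose members are pairs `{x, y}`, `x ∈ B₁`, `y ∈ B₂`, for two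
disjoint members `B₁, B₂` of `𝒞`. -/
theorem hall_of_subset_pairs {𝒜' : Finset (Finset α)} (h𝒜' : 𝒜' ⊆ 𝒞) {B₁ B₂ : Finset α} (hB₁ : B₁ ∈ 𝒞)
    (hB₂ : B₂ ∈ 𝒞) (hd : Disjoint B₁ B₂)
    (hK : 𝒜' ⊆ (B₁ ×ˢ B₂).image (fun x : α × α => ({x.1, x.2} : Finset α))) :
    𝒜'.card ≤ (nbr 𝒞 𝒜').card := by
  by_cases hint : ∀ D₁ ∈ 𝒜', ∀ D₂ ∈ 𝒜', ¬ Disjoint D₁ D₂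
  · exact hall_intersecting hpair hdeg h𝒜' hint
  obtain ⟨D₁, hD₁, D₂, hD₂, hdis⟩ : ∃ D₁ ∈ 𝒜', ∃ D₂ ∈ 𝒜', Disjoint D₁ D₂ := by
    by_contra hcon
    apply hint
    intro D₁ h1 D₂ h2 hd'
    exact hcon ⟨D₁, h1, D₂, h2, hd'⟩
  obtain ⟨u₁, u₂, v₁, v₂, hB₁eq, hB₂eq, hD₁eq, hD₂eq⟩ :=
    exists_opposite (hpair B₁ hB₁) (hpair B₂ hB₂) (hK hD₁) (hK hD₂) hdis
  subst hD₁eq hD₂eq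
  -- the four pairs of `K`
  have hu : u₁ ≠ u₂ := fun h => disjoint_left.1 hdis (mem_insert_self _ _) (h ▸ mem_insert_self _ _)
  have hv : v₁ ≠ v₂ := fun h =>
    disjoint_left.1 hdis (mem_insert_of_mem (mem_singleton_self _)) (h ▸ mem_insert_of_mem (mem_singleton_self _))
  have hB₁B₂ : ∀ u ∈ B₁, ∀ v ∈ B₂, u ≠ v := fun u hu v hv h => disjoint_left.1 hd hu (h ▸ hv)
  have hu₁v₁ : u₁ ≠ v₁ := hB₁B₂ u₁ (by rw [hB₁eq]; exact mem_insert_self _ _) v₁ (by rw [hB₂eq]; exact mem_insert_self _ _)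
  have hu₁v₂ : u₁ ≠ v₂ := hB₁B₂ u₁ (by rw [hB₁eq]; exact mem_insert_self _ _) v₂
    (by rw [hB₂eq]; exact mem_insert_of_mem (mem_singleton_self _))
  have hu₂v₁ : u₂ ≠ v₁ := hB₁B₂ u₂ (by rw [hB₁eq]; exact mem_insert_of_mem (mem_singleton_self _)) v₁
    (by rw [hB₂eq]; exact mem_insert_self _ _)
  have hu₂v₂ : u₂ ≠ v₂ := hB₁B₂ u₂ (by rw [hB₁eq]; exact mem_insert_of_mem (mem_singleton_self _)) v₂
    (by rw [hB₂eq]; exact mem_insert_of_mem (mem_singleton_self _))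
  -- every member of `𝒜'` is one of the four pairs
  have hfour : ∀ D ∈ 𝒜', D = {u₁, v₁} ∨ D = {u₂, v₂} ∨ D = {u₁, v₂} ∨ D = {u₂, v₁} := by
    intro D hD
    have := hK hD
    rw [mem_image] at this
    obtain ⟨⟨u, v⟩, huv, rfl⟩ := this
    rw [mem_product, hB₁eq, hB₂eq] at huv
    simp only [mem_insert, mem_singleton] at huv
    rcases huv with ⟨rfl | rfl, rfl | rfl⟩ <;> simp
  -- the two given members are neighbours
  have hN₁ : ({u₁, v₁} : Finset α) ∈ nbr 𝒞 𝒜' := mem_nbr_of_disjoint (h𝒜' hD₁) hD₂ hdis.symm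
  have hN₂ : ({u₂, v₂} : Finset α) ∈ nbr 𝒞 𝒜' := mem_nbr_of_disjoint (h𝒜' hD₂) hD₁ hdis
  have h12 : ({u₁, v₁} : Finset α) ≠ {u₂, v₂} := by
    intro h
    have : u₁ ∈ ({u₂, v₂} : Finset α) := h ▸ mem_insert_self _ _
    rw [mem_insert, mem_singleton] at this
    rcases this with h' | h'
    · exact hu h'
    · exact hu₁v₂ h'
  -- the other two pairs are disjoint from each other and meet both given members
  have hdis34 : Disjoint ({u₁, v₂} : Finset α) {u₂, v₁} := by
    rw [disjoint_left]
    intro x hx hx'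
    rw [mem_insert, mem_singleton] at hx hx'
    rcases hx with rfl | rfl <;> rcases hx' with h | h
    · exact hu h
    · exact hu₁v₁ h
    · exact hu₂v₂ h.symm
    · exact hv h.symm
  have hmeet3 : ¬ Disjoint ({u₁, v₂} : Finset α) {u₁, v₁} := by
    rw [not_disjoint_iff]
    exact ⟨u₁, mem_insert_self _ _, mem_insert_self _ _⟩
  have hmeet3' : ¬ Disjoint ({u₁, v₂} : Finset α) {u₂, v₂} := by
    rw [not_disjoint_iff]
    exact ⟨v₂, mem_insert_of_mem (mem_singleton_self _), mem_insert_of_mem (mem_singleton_self _)⟩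
  have hmeet4 : ¬ Disjoint ({u₂, v₁} : Finset α) {u₁, v₁} := by
    rw [not_disjoint_iff]
    exact ⟨v₁, mem_insert_of_mem (mem_singleton_self _), mem_insert_of_mem (mem_singleton_self _)⟩
  have hmeet4' : ¬ Disjoint ({u₂, v₁} : Finset α) {u₂, v₂} := by
    rw [not_disjoint_iff]
    exact ⟨u₂, mem_insert_self _ _, mem_insert_self _ _⟩
  by_cases h3 : ({u₁, v₂} : Finset α) ∈ 𝒜'
  · by_cases h4 : ({u₂, v₁} : Finset α) ∈ 𝒜'
    · -- all four pairs are present: `𝒜' ⊆ nbr`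
      apply card_le_card
      intro D hD
      rcases hfour D hD with rfl | rfl | rfl | rfl
      · exact hN₁
      · exact hN₂
      · exact mem_nbr_of_disjoint (h𝒜' h3) h4 hdis34.symm
      · exact mem_nbr_of_disjoint (h𝒜' h4) h3 hdis34
    · -- three pairs at most: the third has a disjoint member by (H1)
      obtain ⟨C', hC', hdC'⟩ := exists_disjoint_mem hpair hdeg (h𝒜' h3)
      have hN₃ : C' ∈ nbr 𝒞 𝒜' := mem_nbr_of_disjoint hC' h3 hdC'
      have hC'1 : C' ≠ {u₁, v₁} := fun h => hmeet3 (h ▸ hdC')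
      have hC'2 : C' ≠ {u₂, v₂} := fun h => hmeet3' (h ▸ hdC')
      have hA : 𝒜' ⊆ {({u₁, v₁} : Finset α), {u₂, v₂}, {u₁, v₂}} := by
        intro D hD
        rcases hfour D hD with rfl | rfl | rfl | rfl
        · exact mem_insert_self _ _
        · exact mem_insert_of_mem (mem_insert_self _ _)
        · exact mem_insert_of_mem (mem_insert_of_mem (mem_singleton_self _))
        · exact absurd hD h4
      have hNsub : ({({u₁, v₁} : Finset α), {u₂, v₂}, C'} : Finset (Finset α)) ⊆ nbr 𝒞 𝒜' := by
        intro D hD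
        rw [mem_insert, mem_insert, mem_singleton] at hD
        rcases hD with rfl | rfl | rfl
        · exact hN₁
        · exact hN₂
        · exact hN₃
      have hA3 := card_le_card hA
      have hN3 := card_le_card hNsub
      have hc1 : ({({u₁, v₁} : Finset α), {u₂, v₂}, {u₁, v₂}} : Finset (Finset α)).card ≤ 3 :=
        card_le_three
      have hc2 : ({({u₁, v₁} : Finset α), {u₂, v₂}, C'} : Finset (Finset α)).card = 3 := by
        rw [card_insert_of_notMem, card_pair (Ne.symm hC'2)]
        rw [mem_insert, mem_singleton]
        rintro (h | h)
        · exact h12 h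
        · exact hC'1 h.symm
      omega
  · by_cases h4 : ({u₂, v₁} : Finset α) ∈ 𝒜'
    · -- symmetric: the fourth pair is the third member
      obtain ⟨C', hC', hdC'⟩ := exists_disjoint_mem hpair hdeg (h𝒜' h4)
      have hN₃ : C' ∈ nbr 𝒞 𝒜' := mem_nbr_of_disjoint hC' h4 hdC'
      have hC'1 : C' ≠ {u₁, v₁} := fun h => hmeet4 (h ▸ hdC')
      have hC'2 : C' ≠ {u₂, v₂} := fun h => hmeet4' (h ▸ hdC')
      have hA : 𝒜' ⊆ {({u₁, v₁} : Finset α), {u₂, v₂}, {u₂, v₁}} := by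
        intro D hD
        rcases hfour D hD with rfl | rfl | rfl | rfl
        · exact mem_insert_self _ _
        · exact mem_insert_of_mem (mem_insert_self _ _)
        · exact absurd hD h3
        · exact mem_insert_of_mem (mem_insert_of_mem (mem_singleton_self _))
      have hNsub : ({({u₁, v₁} : Finset α), {u₂, v₂}, C'} : Finset (Finset α)) ⊆ nbr 𝒞 𝒜' := by
        intro D hD
        rw [mem_insert, mem_insert, mem_singleton] at hD
        rcases hD with rfl | rfl | rfl
        · exact hN₁
        · exact hN₂
        · exact hN₃
      have hA3 := card_le_card hA
      have hN3 := card_le_card hNsub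
      have hc1 : ({({u₁, v₁} : Finset α), {u₂, v₂}, {u₂, v₁}} : Finset (Finset α)).card ≤ 3 :=
        card_le_three
      have hc2 : ({({u₁, v₁} : Finset α), {u₂, v₂}, C'} : Finset (Finset α)).card = 3 := by
        rw [card_insert_of_notMem, card_pair (Ne.symm hC'2)]
        rw [mem_insert, mem_singleton]
        rintro (h | h)
        · exact h12 h
        · exact hC'1 h.symm
      omega
    · -- only the two given members
      have hA : 𝒜' ⊆ {({u₁, v₁} : Finset α), {u₂, v₂}} := by
        intro D hD
        rcases hfour D hD with rfl | rfl | rfl | rfl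
        · exact mem_insert_self _ _
        · exact mem_insert_of_mem (mem_singleton_self _)
        · exact absurd hD h3
        · exact absurd hD h4
      have hNsub : ({({u₁, v₁} : Finset α), {u₂, v₂}} : Finset (Finset α)) ⊆ nbr 𝒞 𝒜' := by
        intro D hD
        rw [mem_insert, mem_singleton] at hD
        rcases hD with rfl | rfl
        · exact hN₁
        · exact hN₂
      have hA2 := card_le_card hA
      have hN2 := card_le_card hNsub
      omega

/-! ### The lemma -/

/-- **Hall's condition for disjointness on a family of pairs of minimum degree `≥ 3`.**  If every point of a
member of `𝒞` lies in at least three members, then every `𝒜 ⊆ 𝒞` has at least `#𝒜` members of `𝒞` disjoint from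
some member of `𝒜`. -/
theorem hall_disjoint_of_degree {𝒜 : Finset (Finset α)} (h𝒜 : 𝒜 ⊆ 𝒞) : 𝒜.card ≤ (nbr 𝒞 𝒜).card := by
  by_cases hint : ∀ B₁ ∈ 𝒜, ∀ B₂ ∈ 𝒜, ¬ Disjoint B₁ B₂
  · exact hall_intersecting hpair hdeg h𝒜 hint
  obtain ⟨B₁, hB₁, B₂, hB₂, hd⟩ : ∃ B₁ ∈ 𝒜, ∃ B₂ ∈ 𝒜, Disjoint B₁ B₂ := by
    by_contra hcon
    apply hint
    intro B₁ h1 B₂ h2 hd'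
    exact hcon ⟨B₁, h1, B₂, h2, hd'⟩
  apply card_le_card_nbr_of_perp h𝒜
  exact hall_of_subset_pairs hpair hdeg (filter_subset _ _) (h𝒜 hB₁) (h𝒜 hB₂) hd
    (perp_subset_pairs hpair hB₁ hB₂ hd)

end Pairs

end PercRepro.HallDisjoint
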